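import Literature.NumberTheory.Automorphic.UnboundedDenominators

/-!
# Unbounded denominators (Calegari–Dimitrov–Tang): the conclusion as `Γ(N)`-invariance

Companion of `Literature/NumberTheory/Automorphic/UnboundedDenominators.lean` (the named facts
`CalegariDimitrovTang2025_unboundedDenominators[_algInt]`, their non-positive-weight cases and the
reductions `…of_pos_weight_case`) and of `UnboundedDenominatorsProofs.lean` /
`WohlfahrtTheorem.lean` (Wohlfahrt's theorem). Sorry-free theorems only; no definition, no named fact (D-0026).

F. Calegari, V. Dimitrov, Y. Tang, *The unbounded denominators conjecture*, J. Amer. Math. Soc.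
**38** (2025), 627–702; arXiv:2109.09040 (arXiv numbering below).

The published proof does not end with a bundled modular form on a congruence subgroup but with an
invariance statement: "`f(τ)` is thus also invariant under `⟨E, Γ(N)⟩ ∩ Γ₀(p)`, which is to say
invariant under a congruence subgroup" (op. cit. §4.3, end of the proof of Proposition 28), after
which Wohlfahrt's theorem and the level bookkeeping of §4.1 identify the level. This file records,
once and for all, that for Mathlib's bundled `ModularForm` the two formulations agree, and restates
the algebraic-integer fact and its positive-weight reduction in the invariance form:

* `exists_congruence_modularForm_coe_eq_iff` — for `f : ModularForm Γ k`, `Γ ≤ SL(2, ℤ)` of finite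
  index: (`∃` congruence `Γ'`, `∃ g : ModularForm Γ' k`, `⇑g = ⇑f`) `↔`
  (`∃ N ≠ 0`, `∀ γ ∈ Γ(N)`, `⇑f ∣[k] γ = ⇑f`). The reverse direction bundles `f` on `Γ(N)`:
  holomorphy is that of `f`, and boundedness at the cusps of `Γ(N)` is boundedness at the cusps of
  `Γ`, all arithmetic groups having the cusps of `SL(2, ℤ)`
  (Mathlib `Subgroup.IsArithmetic.isCusp_iff_isCusp_SL2Z`).
* `CalegariDimitrovTang2025_unboundedDenominators_algInt.iff_gamma_slash_invariant` — the named
  fact `↔` its invariance form.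
* `CalegariDimitrovTang2025_unboundedDenominators_algInt.of_pos_weight_gamma_invariance` — the
  named fact follows from the invariance statement in weights `k ≥ 1` (inline hypothesis, not a
  named fact; weights `k ≤ 0` by `…_algInt.of_weight_nonpos` of the fact file).
-/

noncomputable section

namespace Literature.NumberTheory.Automorphic

open scoped MatrixGroups ModularForm
open UpperHalfPlane CongruenceSubgroup Matrix.SpecialLinearGroup

/-- **The conclusion of the unbounded denominators theorem, unbundled.** For a weight-`k` modular
form `f` on a finite-index subgroup `Γ ≤ SL(2, ℤ)`, the following are equivalent:
(i) `f` is the function of a weight-`k` modular form on some congruence subgroup of `SL(2, ℤ)`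
(the conclusion of `CalegariDimitrovTang2025_unboundedDenominators[_algInt]`);
(ii) for some `N ≠ 0`, `f ∣[k] γ = f` for every `γ ∈ Γ(N)`.
(i) ⇒ (ii): a congruence subgroup contains some `Γ(N)`. (ii) ⇒ (i): take `Γ' = Γ(N)`; `f` is
bounded at the cusps of `Γ(N)` because the cusps of all arithmetic groups are those of `SL(2, ℤ)`
(Mathlib `Subgroup.IsArithmetic.isCusp_iff_isCusp_SL2Z`). This is the form in which
Calegari–Dimitrov–Tang's proof concludes (op. cit. §4.3, end of the proof of Proposition 28).
[cite: CalegariDimitrovTang2025, §4.3, proof of Proposition 28] -/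
theorem exists_congruence_modularForm_coe_eq_iff {k : ℤ}
    {Γ : Subgroup SL(2, ℤ)} [Γ.FiniteIndex] (f : ModularForm (Γ : Subgroup (GL (Fin 2) ℝ)) k) :
    (∃ (Γ' : Subgroup SL(2, ℤ)) (g : ModularForm (Γ' : Subgroup (GL (Fin 2) ℝ)) k),
        IsCongruenceSubgroup Γ' ∧ (g : ℍ → ℂ) = f) ↔
      ∃ N : ℕ, N ≠ 0 ∧ ∀ γ ∈ Gamma N, (⇑f : ℍ → ℂ) ∣[k] (mapGL ℝ γ : GL (Fin 2) ℝ) = ⇑f := by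
  constructor
  · rintro ⟨Γ', g, ⟨N, hN, hle⟩, hgf⟩
    refine ⟨N, hN, fun γ hγ ↦ ?_⟩
    have hmem : (mapGL ℝ γ : GL (Fin 2) ℝ) ∈ (Γ' : Subgroup (GL (Fin 2) ℝ)) :=
      Subgroup.mem_map_of_mem _ (hle hγ)
    simpa only [hgf] using SlashInvariantForm.slash_action_eqn g _ hmem
  · rintro ⟨N, hN, hinv⟩
    haveI : NeZero N := ⟨hN⟩
    -- bundle `f` as a modular form on `Γ(N)`: invariance is `hinv`, holomorphy is that of `f`, and
    -- the cusps of `Γ(N)` are those of `Γ` (both arithmetic: `isCusp_iff_isCusp_SL2Z`).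
    let g : ModularForm ((Gamma N : Subgroup SL(2, ℤ)) : Subgroup (GL (Fin 2) ℝ)) k :=
      { toFun := f
        slash_action_eq' := by
          rintro _ ⟨γ, hγ, rfl⟩
          exact hinv γ hγ
        holo' := f.holo'
        bdd_at_cusps' := fun hc ↦ f.bdd_at_cusps'
          ((Subgroup.IsArithmetic.isCusp_iff_isCusp_SL2Z _).mpr
            ((Subgroup.IsArithmetic.isCusp_iff_isCusp_SL2Z _).mp hc)) }
    exact ⟨Gamma N, g, Gamma_is_cong_sub N, rfl⟩

/-- `CalegariDimitrovTang2025_unboundedDenominators_algInt` in invariance form: the named fact is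
equivalent to "every weight-`k` modular form on a finite-index `Γ ≤ SL(2, ℤ)` with algebraic-integer
`q`-expansion coefficients (at a positive integral strict period `h`) satisfies `f ∣[k] γ = f` for
all `γ` in some `Γ(N)`, `N ≠ 0`" (`exists_congruence_modularForm_coe_eq_iff` pointwise).
[cite: CalegariDimitrovTang2025, Remark 58 and §4.3 (arXiv:2109.09040 numbering)] -/
theorem CalegariDimitrovTang2025_unboundedDenominators_algInt.iff_gamma_slash_invariant :
    CalegariDimitrovTang2025_unboundedDenominators_algInt ↔
      ∀ (Γ : Subgroup SL(2, ℤ)) [Γ.FiniteIndex] (k : ℤ)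
        (f : ModularForm (Γ : Subgroup (GL (Fin 2) ℝ)) k) (h : ℕ), 0 < h →
        ((h : ℝ) ∈ (Γ : Subgroup (GL (Fin 2) ℝ)).strictPeriods) →
        (∀ n : ℕ, IsIntegral ℤ (PowerSeries.coeff n (qExpansion (h : ℝ) f))) →
        ∃ N : ℕ, N ≠ 0 ∧ ∀ γ ∈ Gamma N, (⇑f : ℍ → ℂ) ∣[k] (mapGL ℝ γ : GL (Fin 2) ℝ) = ⇑f :=
  ⟨fun H Γ _ k f h hh hper hint ↦
      (exists_congruence_modularForm_coe_eq_iff f).mp (H Γ k f h hh hper hint),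
    fun H Γ _ k f h hh hper hint ↦
      (exists_congruence_modularForm_coe_eq_iff f).mpr (H Γ k f h hh hper hint)⟩

/-- **Reduction of the algebraic-integer fact to positive weight and `Γ(N)`-invariance.**
`CalegariDimitrovTang2025_unboundedDenominators_algInt` follows from: every modular form of weight
`k ≥ 1` on a finite-index `Γ ≤ SL(2, ℤ)` whose `q`-expansion (in `e^{2πiτ/h}`, `h` a positive
integral strict period of `Γ`) has algebraic-integer coefficients satisfies `f ∣[k] γ = f` for all
`γ` in some `Γ(N)`, `N ≠ 0` — the theorem proper (Calegari–Dimitrov–Tang, Remark 58 with §§2–6),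
taken as the inline hypothesis `hpos` (deliberately NOT a named fact) so that a future proof closes
the fact through this lemma; weights `k ≤ 0` are settled by `…_algInt.of_weight_nonpos`.
[cite: CalegariDimitrovTang2025, Remark 58 and §4.3 (arXiv:2109.09040 numbering)] -/
theorem CalegariDimitrovTang2025_unboundedDenominators_algInt.of_pos_weight_gamma_invariance
    (hpos : ∀ (Γ : Subgroup SL(2, ℤ)) [Γ.FiniteIndex] (k : ℤ), 1 ≤ k →
      ∀ (f : ModularForm (Γ : Subgroup (GL (Fin 2) ℝ)) k) (h : ℕ), 0 < h →
      ((h : ℝ) ∈ (Γ : Subgroup (GL (Fin 2) ℝ)).strictPeriods) →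
      (∀ n : ℕ, IsIntegral ℤ (PowerSeries.coeff n (qExpansion (h : ℝ) f))) →
      ∃ N : ℕ, N ≠ 0 ∧ ∀ γ ∈ Gamma N, (⇑f : ℍ → ℂ) ∣[k] (mapGL ℝ γ : GL (Fin 2) ℝ) = ⇑f) :
    CalegariDimitrovTang2025_unboundedDenominators_algInt :=
  CalegariDimitrovTang2025_unboundedDenominators_algInt.of_pos_weight_case
    fun Γ _ k hk f h hh hper hint ↦
      (exists_congruence_modularForm_coe_eq_iff f).mpr (hpos Γ k hk f h hh hper hint)

end Literature.NumberTheory.Automorphic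

end
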